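import Mathlib
import Summits.ResolutionOfSingularities.ResolutionOfSingularities.Theses.DefectlessFrames
import Literature.AlgebraicGeometry.Resolution.TranscendenceDefect
import Literature.AlgebraicGeometry.Resolution.Henselization
import Literature.AlgebraicGeometry.Resolution.HenselizedFunctionFields
import Summits.ResolutionOfSingularities.ResolutionOfSingularities.Theorems.DefectlessFramesDefectlessFramesRTwist
import Summits.ResolutionOfSingularities.ResolutionOfSingularities.Theorems.DefectlessFramesDefectlessFramesRSmallAxis
import Summits.ResolutionOfSingularities.ResolutionOfSingularities.Theorems.DefectlessFramesDefectlessFramesRAbhyankar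
import Summits.ResolutionOfSingularities.ResolutionOfSingularities.Theorems.DefectlessFramesDefectlessFramesRDiscrete

/-!
# `DefectlessFramesR` reduced to its kernel (crux stmt-ResolutionOfSingularities-17921, line `Sketch`)

Lead seat prover-line-stmt-ResolutionOfSingularities-17921-0, 2026-08-17 (cycle 1).

The crux `DefectlessFrames.DefectlessFramesR` — every hypersurface frame along a rank-one zero-dimensional
valuation ring over a perfect field is dominated by an integral, general-position, separable frame of
non-increased axis order whose projection is DEFECTLESS — follows from the four LANDED stubs
`stub_dfrTwist` (Zariski A.IV / Nagata re-framing: every conjunct but the defect clause, for every frame),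
`stub_dfrSmallAxis` (axis order `s' < p` ⇒ defectless: Hensel cluster budget + Ostrowski),
`stub_dfrAbhyankar` (transcendence defect `0` ⇒ defectless: generalized stability) and `stub_dfrDiscrete`
(`O` discrete ⇒ defectless: DVRs are separably defectless), together with ONE remaining hypothesis, the KERNEL:
the crux restricted to valuation rings of positive transcendence defect that are not discrete, and to frames of
axis order `≥ p` (or not in general position). `stub_dfrReduction` is that implication, sorry-free: the crux is
closed modulo the kernel (registered stub `stub_dfrKernel` of the skeleton `Cruxes/DefectlessFramesR/Lines/Sketch.lean`).
-/

namespace Summit.ResolutionOfSingularities.ResolutionOfSingularities.Theorems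

open Summit.ResolutionOfSingularities.ResolutionOfSingularities.Theses.DefectlessFrames

/-- The glue with all five stubs as hypotheses (sorry-free): twist the frame (`stub_dfrTwist`), then dispatch the defect clause on
`s' < p` (`stub_dfrSmallAxis`), transcendence defect `0` (`stub_dfrAbhyankar`), `O` discrete (`stub_dfrDiscrete`);
the remaining case is `stub_dfrKernel` applied to the ORIGINAL frame (its axis order is then `≥ p` whenever it is in
general position, because `p ≤ s' ≤ s`). -/
theorem dfrReduction_of_stubs
    (hT : ∀ p : ℕ, p.Prime → ∀ (k K : Type) [Field k] [CharP k p] [PerfectField k] [Field K] [Algebra k K], (⊤ : IntermediateField k K).FG → ∀ O : ValuationSubring K, ∀ hk : (∀ c : k, algebraMap k K c ∈ O), Nonempty O.valuation.RankOne → (∀ x ∈ O, ∃ f : Polynomial k, f ≠ 0 ∧ Polynomial.aeval x f ∈ O.nonunits) → let ρ : k →+* IsLocalRing.ResidueField O := (IsLocalRing.residue O).comp ((algebraMap k K).codRestrict O hk); let axis : (m : ℕ) → (Fin m → O) → MvPolynomial (Fin (m + 1)) k → Polynomial (IsLocalRing.ResidueField O) := fun _ w g => MvPolynomial.eval₂ (Polynomial.C.comp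 ρ) (Fin.snoc (fun j => Polynomial.C (IsLocalRing.residue O (w j))) Polynomial.X) g; ∀ (n : ℕ) (y : Fin n → O) (z : O) (f : MvPolynomial (Fin (n + 1)) k), AlgebraicIndependent k (fun i => (y i : K)) → IntermediateField.adjoin k (Set.range (fun i => (y i : K)) ∪ {(z : K)}) = ⊤ → Ideal.span {f} = RingHom.ker (MvPolynomial.aeval (Fin.snoc (fun i => (y i : K)) (z : K)) : MvPolynomial (Fin (n + 1)) k →ₐ[k] K) → f ≠ 0 → ∃ (y' : Fin n → O) (z' : O) (f' : MvPolynomial (Fin (n + 1)) k), AlgebraicIndependent k (fun i => (y' i : K)) ∧ IsIntegral (Algebra.adjoin k (Set.range fun i => (y' i : K))) (z' : K) ∧ IntermediateField.adjoin k (Set.range (fun i => (y' i : K)) ∪ {(z' : K)}) = ⊤ ∧ Ideal.span {f'} = RingHom.ker (MvPolynomial.aeval (Fin.snoc (fun i => (y' i : K)) (z' : K)) : MvPolynomial (Fin (n + 1)) k →ₐ[k] K) ∧ (∀ i, (y i : K) ∈ Algebra.adjoin k (Set.range (fun i => (y' i : K)) ∪ {(z' : K)})) ∧ (z : K) ∈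 Algebra.adjoin k (Set.range (fun i => (y' i : K)) ∪ {(z' : K)}) ∧ axis n y' f' ≠ 0 ∧ (axis n y f ≠ 0 → (axis n y' f').rootMultiplicity (IsLocalRing.residue O z') ≤ (axis n y f).rootMultiplicity (IsLocalRing.residue O z)) ∧ IsSeparable (IntermediateField.adjoin k (Set.range fun i => (y' i : K))) (z' : K))
    (hS : ∀ p : ℕ, p.Prime → ∀ (k K : Type) [Field k] [CharP k p] [PerfectField k] [Field K] [Algebra k K], (⊤ : IntermediateField k K).FG → ∀ O : ValuationSubring K, ∀ hk : (∀ c : k, algebraMap k K c ∈ O), Nonempty O.valuation.RankOne → (∀ x ∈ O, ∃ f : Polynomial k, f ≠ 0 ∧ Polynomial.aeval x f ∈ O.nonunits) → let ρ : k →+* IsLocalRing.ResidueField O := (IsLocalRing.residue O).comp ((algebraMap k K).codRestrict O hk); let axis : (m : ℕ) → (Fin m → O) → MvPolynomial (Fin (m + 1)) k → Polynomial (IsLocalRing.ResidueField O) := fun _ w g => MvPolynomial.eval₂ (Polynomial.C.comp ρ) (Fin.snoc (fun j => Polynomial.C (IsLocalRing.residue O (w j))) Polynomial.X) g; ∀ (n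 : ℕ) (y' : Fin n → O) (z' : O) (f' : MvPolynomial (Fin (n + 1)) k), AlgebraicIndependent k (fun i => (y' i : K)) → IsIntegral (Algebra.adjoin k (Set.range fun i => (y' i : K))) (z' : K) → IntermediateField.adjoin k (Set.range (fun i => (y' i : K)) ∪ {(z' : K)}) = ⊤ → Ideal.span {f'} = RingHom.ker (MvPolynomial.aeval (Fin.snoc (fun i => (y' i : K)) (z' : K)) : MvPolynomial (Fin (n + 1)) k →ₐ[k] K) → axis n y' f' ≠ 0 → IsSeparable (IntermediateField.adjoin k (Set.range fun i => (y' i : K))) (z' : K) → (axis n y' f').rootMultiplicity (IsLocalRing.residue O z') < p → ∀ (Ω : Type) [Field Ω] [Algebra K Ω] [IsAlgClosure K Ω] (V : ValuationSubring Ω), V.comap (algebraMap K Ω) = O → let F : Subfield Ω := (IntermediateField.adjoin k (Set.range fun i => (y' i : K))).toSubfield.map (algebraMap K Ω); Literature.AlgebraicGeometry.Resolution.IsDefectlessExtension V (Literature.AlgebraicGeometry.Resolution.henselization V F) (Literature.AlgebraicGeometry.Resolution.henselization V F ⊔ (algebraMap K Ω).fieldRange))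
    (hA : ∀ p : ℕ, p.Prime → ∀ (k K : Type) [Field k] [CharP k p] [PerfectField k] [Field K] [Algebra k K], (⊤ : IntermediateField k K).FG → ∀ O : ValuationSubring K, ∀ hk : (∀ c : k, algebraMap k K c ∈ O), Nonempty O.valuation.RankOne → (∀ x ∈ O, ∃ f : Polynomial k, f ≠ 0 ∧ Polynomial.aeval x f ∈ O.nonunits) → Literature.AlgebraicGeometry.Resolution.transcendenceDefect k O hk = 0 → ∀ (n : ℕ) (y' : Fin n → O) (z' : O), AlgebraicIndependent k (fun i => (y' i : K)) → IsIntegral (Algebra.adjoin k (Set.range fun i => (y' i : K))) (z' : K) → IntermediateField.adjoin k (Set.range (fun i => (y' i : K)) ∪ {(z' : K)}) = ⊤ → IsSeparable (IntermediateField.adjoin k (Set.range fun i => (y' i : K))) (z' : K) → ∀ (Ω : Type) [Field Ω] [Algebra K Ω] [IsAlgClosure K Ω] (V : ValuationSubring Ω), V.comap (algebraMap K Ω) = O → let F : Subfield Ω := (IntermediateField.adjoin k (Set.range fun i => (y' i : K))).toSubfield.map (algebraMap K Ω); Literature.AlgebraicGeometry.Resolution.IsDefectlessExtension V (Literature.AlgebraicGeometry.Resolution.henselization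 V F) (Literature.AlgebraicGeometry.Resolution.henselization V F ⊔ (algebraMap K Ω).fieldRange))
    (hD : ∀ p : ℕ, p.Prime → ∀ (k K : Type) [Field k] [CharP k p] [PerfectField k] [Field K] [Algebra k K], (⊤ : IntermediateField k K).FG → ∀ O : ValuationSubring K, ∀ hk : (∀ c : k, algebraMap k K c ∈ O), Nonempty O.valuation.RankOne → (∀ x ∈ O, ∃ f : Polynomial k, f ≠ 0 ∧ Polynomial.aeval x f ∈ O.nonunits) → IsDiscreteValuationRing O → ∀ (n : ℕ) (y' : Fin n → O) (z' : O), AlgebraicIndependent k (fun i => (y' i : K)) → IsIntegral (Algebra.adjoin k (Set.range fun i => (y' i : K))) (z' : K) → IntermediateField.adjoin k (Set.range (fun i => (y' i : K)) ∪ {(z' : K)}) = ⊤ → IsSeparable (IntermediateField.adjoin k (Set.range fun i => (y' i : K))) (z' : K) → ∀ (Ω : Type) [Field Ω] [Algebra K Ω] [IsAlgClosure K Ω] (V : ValuationSubring Ω), V.comap (algebraMap K Ω) = O → let F : Subfield Ω := (IntermediateField.adjoin k (Set.range fun i => (y' i : K))).toSubfield.map (algebraMap K Ω); Literature.AlgebraicGeometry.Resolution.IsDefectlessExtension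 V (Literature.AlgebraicGeometry.Resolution.henselization V F) (Literature.AlgebraicGeometry.Resolution.henselization V F ⊔ (algebraMap K Ω).fieldRange))
    (hK : ∀ p : ℕ, p.Prime → ∀ (k K : Type) [Field k] [CharP k p] [PerfectField k] [Field K] [Algebra k K], (⊤ : IntermediateField k K).FG → ∀ O : ValuationSubring K, ∀ hk : (∀ c : k, algebraMap k K c ∈ O), Nonempty O.valuation.RankOne → (∀ x ∈ O, ∃ f : Polynomial k, f ≠ 0 ∧ Polynomial.aeval x f ∈ O.nonunits) → Literature.AlgebraicGeometry.Resolution.transcendenceDefect k O hk ≠ 0 → ¬ IsDiscreteValuationRing O → let ρ : k →+* IsLocalRing.ResidueField O := (IsLocalRing.residue O).comp ((algebraMap k K).codRestrict O hk); let axis : (m : ℕ) → (Fin m → O) → MvPolynomial (Fin (m + 1)) k → Polynomial (IsLocalRing.ResidueField O) := fun _ w g => MvPolynomial.eval₂ (Polynomial.C.comp ρ) (Fin.snoc (fun j => Polynomial.C (IsLocalRing.residue O (w j))) Polynomial.X) g; ∀ (n : ℕ) (y : Fin n → O) (z : O) (f : MvPolynomial (Fin (n + 1)) k), AlgebraicIndependent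 k (fun i => (y i : K)) → IntermediateField.adjoin k (Set.range (fun i => (y i : K)) ∪ {(z : K)}) = ⊤ → Ideal.span {f} = RingHom.ker (MvPolynomial.aeval (Fin.snoc (fun i => (y i : K)) (z : K)) : MvPolynomial (Fin (n + 1)) k →ₐ[k] K) → f ≠ 0 → (axis n y f ≠ 0 → p ≤ (axis n y f).rootMultiplicity (IsLocalRing.residue O z)) → ∃ (y' : Fin n → O) (z' : O) (f' : MvPolynomial (Fin (n + 1)) k), AlgebraicIndependent k (fun i => (y' i : K)) ∧ IsIntegral (Algebra.adjoin k (Set.range fun i => (y' i : K))) (z' : K) ∧ IntermediateField.adjoin k (Set.range (fun i => (y' i : K)) ∪ {(z' : K)}) = ⊤ ∧ Ideal.span {f'} = RingHom.ker (MvPolynomial.aeval (Fin.snoc (fun i => (y' i : K)) (z' : K)) : MvPolynomial (Fin (n + 1)) k →ₐ[k] K) ∧ (∀ i, (y i : K) ∈ Algebra.adjoin k (Set.range (fun i => (y' i : K)) ∪ {(z' : K)})) ∧ (z : K) ∈ Algebra.adjoin k (Set.range (fun i => (y' i : K)) ∪ {(z' : K)}) ∧ axis n y' f' ≠ 0 ∧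 (axis n y f ≠ 0 → (axis n y' f').rootMultiplicity (IsLocalRing.residue O z') ≤ (axis n y f).rootMultiplicity (IsLocalRing.residue O z)) ∧ IsSeparable (IntermediateField.adjoin k (Set.range fun i => (y' i : K))) (z' : K) ∧ ∀ (Ω : Type) [Field Ω] [Algebra K Ω] [IsAlgClosure K Ω] (V : ValuationSubring Ω), V.comap (algebraMap K Ω) = O → let F : Subfield Ω := (IntermediateField.adjoin k (Set.range fun i => (y' i : K))).toSubfield.map (algebraMap K Ω); let Fh : Subfield Ω := (IntermediateField.lift (IntermediateField.fixedField (ValuationSubring.decompositionSubgroup F (V.comap (algebraMap (separableClosure F Ω) Ω))))).toSubfield; let T : Subfield Ω := Fh ⊔ (algebraMap K Ω).fieldRange; Fh ≤ T ∧ 0 < Subfield.relfinrank Fh T ∧ Subfield.relfinrank Fh T = (Literature.AlgebraicGeometry.Resolution.valueSubgroup Fh V).relIndex (Literature.AlgebraicGeometry.Resolution.valueSubgroup T V) * (Literature.AlgebraicGeometry.Resolution.residueSubfield Fh V).relfinrank (Literature.AlgebraicGeometry.Resolution.residueSubfield T V)) :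
    DefectlessFramesR := by
  intro p hp k K _ _ _ _ _ hfg O hk hR hZ ρ axis n y z f hy hadj hker hf
  obtain ⟨y', z', f', h1, h2, h3, h4, h5, h6, h7, h8, h9⟩ :=
    hT p hp k K hfg O hk hR hZ n y z f hy hadj hker hf
  by_cases hsmall : (axis n y' f').rootMultiplicity (IsLocalRing.residue O z') < p
  · exact ⟨y', z', f', h1, h2, h3, h4, h5, h6, h7, h8, h9, fun Ω _ _ _ V hV =>
      hS p hp k K hfg O hk hR hZ n y' z' f' h1 h2 h3 h4 h7 h9 hsmall Ω V hV⟩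
  by_cases habh : Literature.AlgebraicGeometry.Resolution.transcendenceDefect k O hk = 0
  · exact ⟨y', z', f', h1, h2, h3, h4, h5, h6, h7, h8, h9, fun Ω _ _ _ V hV =>
      hA p hp k K hfg O hk hR hZ habh n y' z' h1 h2 h3 h9 Ω V hV⟩
  by_cases hdisc : IsDiscreteValuationRing O
  · exact ⟨y', z', f', h1, h2, h3, h4, h5, h6, h7, h8, h9, fun Ω _ _ _ V hV =>
      hD p hp k K hfg O hk hR hZ hdisc n y' z' h1 h2 h3 h9 Ω V hV⟩
  exact hK p hp k K hfg O hk hR hZ habh hdisc n y z f hy hadj hker hf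
    (fun hax => le_trans (not_lt.mp hsmall) (h8 hax))

/-- **`DefectlessFramesR` modulo its kernel.** If the crux holds at every rank-one zero-dimensional valuation
ring of POSITIVE transcendence defect that is NOT a discrete valuation ring, for every frame of axis order `≥ p`
(when in general position), then it holds outright — the other cases being the landed stubs `stub_dfrTwist`,
`stub_dfrSmallAxis`, `stub_dfrAbhyankar`, `stub_dfrDiscrete`. [folklore] -/
theorem stub_dfrReduction : (∀ p : ℕ, p.Prime → ∀ (k K : Type) [Field k] [CharP k p] [PerfectField k] [Field K] [Algebra k K], (⊤ : IntermediateField k K).FG → ∀ O : ValuationSubring K, ∀ hk : (∀ c : k, algebraMap k K c ∈ O), Nonempty O.valuation.RankOne → (∀ x ∈ O, ∃ f : Polynomial k, f ≠ 0 ∧ Polynomial.aeval x f ∈ O.nonunits) → Literature.AlgebraicGeometry.Resolution.transcendenceDefect k O hk ≠ 0 → ¬ IsDiscreteValuationRing O → let ρ : k →+* IsLocalRing.ResidueField O := (IsLocalRing.residue O).comp ((algebraMap k K).codRestrict O hk); let axis : (m : ℕ) → (Fin m → O) → MvPolynomial (Fin (m + 1)) k → Polynomial (IsLocalRing.ResidueField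 O) := fun _ w g => MvPolynomial.eval₂ (Polynomial.C.comp ρ) (Fin.snoc (fun j => Polynomial.C (IsLocalRing.residue O (w j))) Polynomial.X) g; ∀ (n : ℕ) (y : Fin n → O) (z : O) (f : MvPolynomial (Fin (n + 1)) k), AlgebraicIndependent k (fun i => (y i : K)) → IntermediateField.adjoin k (Set.range (fun i => (y i : K)) ∪ {(z : K)}) = ⊤ → Ideal.span {f} = RingHom.ker (MvPolynomial.aeval (Fin.snoc (fun i => (y i : K)) (z : K)) : MvPolynomial (Fin (n + 1)) k →ₐ[k] K) → f ≠ 0 → (axis n y f ≠ 0 → p ≤ (axis n y f).rootMultiplicity (IsLocalRing.residue O z)) → ∃ (y' : Fin n → O) (z' : O) (f' : MvPolynomial (Fin (n + 1)) k), AlgebraicIndependent k (fun i => (y' i : K)) ∧ IsIntegral (Algebra.adjoin k (Set.range fun i => (y' i : K))) (z' : K) ∧ IntermediateField.adjoin k (Set.range (fun i => (y' i : K)) ∪ {(z' : K)}) = ⊤ ∧ Ideal.span {f'} = RingHom.ker (MvPolynomial.aeval (Fin.snoc (fun i => (y' i : K)) (z' : K)) : MvPolynomial (Fin (n + 1)) k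 →ₐ[k] K) ∧ (∀ i, (y i : K) ∈ Algebra.adjoin k (Set.range (fun i => (y' i : K)) ∪ {(z' : K)})) ∧ (z : K) ∈ Algebra.adjoin k (Set.range (fun i => (y' i : K)) ∪ {(z' : K)}) ∧ axis n y' f' ≠ 0 ∧ (axis n y f ≠ 0 → (axis n y' f').rootMultiplicity (IsLocalRing.residue O z') ≤ (axis n y f).rootMultiplicity (IsLocalRing.residue O z)) ∧ IsSeparable (IntermediateField.adjoin k (Set.range fun i => (y' i : K))) (z' : K) ∧ ∀ (Ω : Type) [Field Ω] [Algebra K Ω] [IsAlgClosure K Ω] (V : ValuationSubring Ω), V.comap (algebraMap K Ω) = O → let F : Subfield Ω := (IntermediateField.adjoin k (Set.range fun i => (y' i : K))).toSubfield.map (algebraMap K Ω); let Fh : Subfield Ω := (IntermediateField.lift (IntermediateField.fixedField (ValuationSubring.decompositionSubgroup F (V.comap (algebraMap (separableClosure F Ω) Ω))))).toSubfield; let T : Subfield Ω := Fh ⊔ (algebraMap K Ω).fieldRange; Fh ≤ T ∧ 0 < Subfield.relfinrank Fh T ∧ Subfield.relfinrank Fh T = (Literature.AlgebraicGeometry.Resolution.valueSubgroup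 Fh V).relIndex (Literature.AlgebraicGeometry.Resolution.valueSubgroup T V) * (Literature.AlgebraicGeometry.Resolution.residueSubfield Fh V).relfinrank (Literature.AlgebraicGeometry.Resolution.residueSubfield T V)) → Summit.ResolutionOfSingularities.ResolutionOfSingularities.Theses.DefectlessFrames.DefectlessFramesR :=
  fun hK => dfrReduction_of_stubs stub_dfrTwist stub_dfrSmallAxis stub_dfrAbhyankar stub_dfrDiscrete hK

end Summit.ResolutionOfSingularities.ResolutionOfSingularities.Theorems
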